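import Literature.MathematicalPhysics.QuantumFieldTheory.Balaban1983to89.B9Cor36GpCubeEntriesAtV
import Literature.MathematicalPhysics.QuantumFieldTheory.Balaban1983to89.B9Cor36CutoffSecondDiff

/-!
# `Balaban1983to89.B9Cor36GpCubeLocAtMember` — [Balaban1985BackgroundPropagators] COROLLARY 3.6 p. 408 + (3.87)–(3.89) p. 409 AT ONE COVER CUBE □,
# READ AT THE MEMBER: the (3.42)-block `hE` of M5.5 FILE 6 for the U-constant cube letter `O_□ = χ_□R(u)⁻¹G′_□(Ṽ_□)R(u)χ_□` — the four entries
# `|η²O_□λ|, |η⁻¹∇_U(η²O_□)λ|, |(η²O_□)(η⁻¹∇*_U)λ|, |η⁻²Δ_U(η²O_□)λ| ≦ B₀[(Lⁿη)², Lⁿη, Lⁿη, 1]e^{−δd}|λ|` over the member's geometry — sub-row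
# G-B9-LETTERS, module M5.1b-G′ (site sector), FILE 7b-D2 (the last file) of seat p33's plan

statement-level skeleton of published theorems with citation tags; proofs where landed; nothing here is a claim about the Yang–Mills mass gap

CITATION HEADER (lean-in-tree rule).  B9 = T. Bałaban, *Propagators for lattice gauge theories in a background field*, Commun. Math. Phys. **99** (1985)
389–434 [Balaban1985BackgroundPropagators] (held `paper:balaban1985-cmp99-background-propagators`; journal page = PDF page + 388).  Cor. 3.6 p. 408
[PDF 20] l. 3–9 «Applying the gauge transformation u we get U′ = U^u = e^{iηA} … All the results of these theorems are gauge invariant, so they hold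
for the configuration U also»; (3.31) p. 395 (`∇_{U^u}R(u) = R(u)∇_U`, `Δ_{U^u}R(u) = R(u)Δ_U`); (3.87)–(3.89) p. 409 [PDF 21] (`G′₀ = Σ_□ h_□G′_□h_□`,
the commutator `K(h_□)` of `Δ_U` with a cut-off and its size «exactly the bound (2.44) of [4]»); (3.100) p. 413 (the lattice Leibniz rule); p. 410
l. 14–15 («G′_□ depends on U restricted to Ω₀(□) ⊂ □̃⁵»); Thm 3.1 (3.42) p. 397.  [4] = [Balaban1984PropagatorsII] (2.39)–(2.44) pp. 229–230, p. 247
«|∂h_□| ≤ O(1)(MLʲη)⁻¹, |Δh_□| ≤ O(1)(MLʲη)⁻²», (2.52)–(2.55) p. 232.  Rows B9.Cor3.6 × B9.Eq3.87 × B9.Thm3.1 (cells only; no row head changes).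

WHY THIS FILE (cell lit-balaban, sub-row G-B9-LETTERS, module M5.1b-G′ booked to seat p33; design memo `lit-balaban-p33/COR35GP-STATEMENTS-p33.md` v1,
ruling (R); lead RULING #8 «7b `hE` = the successor's first item»).  p21's M5.5 FILE 6 (`B9Thm37GpTorusRegularFinal.eBlock_kernelFamilySInv_Gp_of_localInverse`)
consumes, per cover cube □, the binder `hE : EBlock (kernelFamilySInv i B cfg (O_□) parS) B₀ δ₀ U₁` for the U-CONSTANT letter of design (R),
`O_□ := locLetterY i □ parSymY u χ_□ Ṽ_□ = χ_□R(u)⁻¹G′_□(Ṽ_□)R(u)χ_□` (FILE 2), where `u` is the gauge of the (3.35) datum, `U^u = e^{iηA}` on the datum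
cube, and `Ṽ_□ = e^{iηχ̃_□A}` (FILE 4).  FILES 7b-A∕C gave the four (3.42)-type majorants of the GENUINE cube letter `conj b(η²G′_□(Ṽ_□))` WITH THE
DERIVATIVES AT `Ṽ_□`, over the cube sequence's geometry (`gp_cube_entries_at_locCfg`); FILE 7b-B the transfer of a sandwiched cube majorant
`M_{g₁}R(γ)⁻¹·M·R(γ)M_{g₂}` to the member's geometry; FILE 7b-D1 the sizes of `∂χ_□`, `∂∂*χ_□`.  THIS FILE closes the module: it writes the member's
derivatives of `η²O_□` — `∇_{U,μ}`, `·∇*_{U,μ}`, `Δ_U` at the MEMBER's configuration `U` — as finite sums of such sandwiches whose inner operators are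
the cube letter with derivatives AT `Ṽ_□` (§2: gauge covariance (3.31) moves `∇_U` through `R(u)⁻¹` as `∇_{U^u}`; the Leibniz rule (3.100) moves it
through `χ_□` at the price of the multipliers `∂χ_□`, `∂∂*χ_□`; and ON THE SUPPORT OF THESE MULTIPLIERS the bond variables of `U^u` that a one-step
operator reads are those of `Ṽ_□` — p. 410 l. 14–15), then applies FILE 7b-B to every term and p21's writer `eBlock_kernelFamilySInv_of_hasMajorant`.

WHAT IS PROVED (4 `def`s∕`abbrev`s with bodies — `SandR`, `Ginner`, `Gmem`, `Lscaled`; 0 sorry; 0 new named facts; standard axioms):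
* §1 POINTWISE TRANSPORT-AND-LOCALISE: `transport_fwd`∕`transport_bwd`∕`transport_lap` (`R(U_μ(z))(R(u)⁻¹Ψ)(z+e_μ) = R(u(z))⁻¹[(∇_{Ṽ,μ}Ψ)(z) + Ψ(z)]`
  etc. wherever `U^u` and `Ṽ` agree on the bond read — from p22's (3.31) laws `cdS_conj`∕`cdsS_conj`∕`lapS_conj`), `transport_bwd_right`, the pointwise
  Leibniz rules `cutMul_cdsS_shift`, `lapS_cutMulY_apply` (n06-l's `cutCommY_lapSL_apply` rearranged);
* §2 THE LETTERS AND THE THREE IDENTITIES in `End_ℝ`: `SandR` (FILE 7b-B's sandwich), `Ginner` (`η²G′_□(Ṽ_□)`, `conj b Ginner = GpVK` by `rfl`), `Gmem`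
  (`η²O_□`, ★`Gmem_apply`), `Lscaled` (`η⁻²Δ_V`); ★★`diffLetter_inl_mul_Gmem` (`(η⁻¹∇_{U,μ})(η²O_□) = Sand(χ⁺, (η⁻¹∇_{Ṽ,μ})η²G′, χ) + Sand(η⁻¹∂⁺χ, η²G′, χ)`),
  ★★`Gmem_mul_diffLetter_inr` (`(η²O_□)(−η⁻¹∇*_{U,μ}) = Sand(χ, η²G′(−η⁻¹∇*_{Ṽ,μ}), χ⁺) + Sand(χ, η²G′, −η⁻¹∂⁺χ)`), ★★`Lscaled_mul_Gmem`
  (`η⁻²Δ_U(η²O_□) = Sand(χ, η⁻²Δ_{Ṽ}η²G′, χ) − Σ_μ[Sand(η⁻¹∂⁺_μχ, (η⁻¹∇_{Ṽ,μ})η²G′, χ) + Sand(−η⁻¹∂⁻_μχ, (−η⁻¹∇*_{Ṽ,μ})η²G′, χ) + Sand(η⁻²∂_μ∂*_μχ, η²G′, χ)]`),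
  all under an abstract agreement hypothesis on a set `N ⊇ supp χ ± e_μ`;
* §3 THE AGREEMENT FROM THE DATUM: `nearC_of_chiY_ne_zero₃`, ★`UboxY_gaugeY_eq_locCfgY` (`U^u = Ṽ_□` on the bonds based within `r ≤ 4.375S_j` when
  `U^u = e^{iηA}` on the datum cube `Q ⊇ NearC(4.375S_j + 1)`), `agree_near`;
* §4 ASSEMBLY: `hasMajorant_congr_op`, `hasMajorant_finset_sum`, `kernel_le`, ★★★`eBlock_locLetterY` (∃ `δ, B₀ > 0`, thresholds `M₀, N₀, T₀` and `a₁`, functions of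
  `d, L, M₂, b` only, such that for every member above threshold, every cover cube, every (3.35) datum `(u, A, Q, C, ξ, Λ)` of FILE 4's form with
  `α₁ := max C (C(1+D₁θ))Λ² ≤ min a₁ ¼`, `u` a bi-contraction, `etaS i = η`, and every background family through `U`: `IsUnit Δ′_{a,□}(Ṽ_□)` AND
  `EBlock (kernelFamilySInv i B cfg (fun _ => locLetterY i □ parSymY u χ_□ Ṽ_□) par) B₀ δ U₁`).

PROOF (ours, assembling the module).  (3.31) + (3.100) pointwise (§1–§2); FILE 4's plateau chain `χ̃_□ = 1` near `supp χ_□` and the datum's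
`U^u = e^{iηA}` on `Q` (§3); FILE 7b-C's entries + FILE 7b-B's transfers (`_decay` for left-weighted terms, `_decay_src` with p05's scale transfer
`hST_geoCK` for the right-weighted term of the `∇*`-entry) + FILE 7b-D1's multiplier sizes + p21's writer (§4).

HONEST SCOPE / NOT CLAIMED.  (i) The rate is `(1 − 9∕5000)·δ_C` with `δ_C = (4∕5)δ₀` of FILE 7b-C (print: «a decay rate arbitrarily close»); the
constant `B₀` is an explicit but unoptimised polynomial in `M₂Σ‖b_j‖`, FILE 7b-C's `B_f`, `D₁θ`, `D₂θ`, `L⁴`, `d + 1`.  (ii) The letter is the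
(R)-DESIGN's `O_□` (FILE 2's header: print restricts `U` to `Ω₀(□)`; here the full-torus cube letter is evaluated at `Ṽ_□`, which agrees with `U^u` on the
bonds within `3.75S_j`); the datum cube `Q ⊇ NearC(4.375S_j + 1)` lies inside print's □̃⁵ — WHICH class cube supplies it is FILE 4's open question (Q1),
not decided here.  (iii) `‖1‖ = 1` (`NormOneClass 𝔸`) and a real basis `b` of `𝔸` with `|b.repr v j| ≤ M₂‖v‖` are assumed, as in FILES 7b-A∕C.
(iv) Nothing on `d = 4`, the continuum, reflection positivity or the mass gap; NOT a node discharge; no row head changes.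

RELATED IN THE TREE, NOT DUPLICATED: `Node00.OpsYLeibnizLetters` (the Leibniz rules as `End_ℂ` identities at def-Y's letters — here the pointwise forms
of n06-l's `B9Thm37CubeCoverCommutators` are consumed BY NAME), p22's `B9CubeLettersInvReadings` ((3.31) laws), p21's `B9CubeLettersInvWriteDict`
(the writer), FILES 2, 4, 7b-A, 7b-B, 7b-C, 7b-D1 of this module.
-/

noncomputable section

namespace Literature.MathematicalPhysics.QuantumFieldTheory.Balaban1983to89.B9Cor36GpCubeLocAtMember

open Literature.MathematicalPhysics.QuantumFieldTheory.Balaban1983to89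
open Literature.MathematicalPhysics.QuantumFieldTheory.Balaban1983to89.B4PartitionUnity22 (thetaProf D1 D2 D1_nonneg D2_nonneg contDiff_thetaProf
  hasCompactSupport_thetaProf)
open Literature.MathematicalPhysics.QuantumFieldTheory.Balaban1983to89.B6RandomWalk (HasMajorant hasMajorant_mono hasMajorant_add hasMajorant_zero)
open Literature.MathematicalPhysics.QuantumFieldTheory.Balaban1983to89.B9Thm34Ext (toB6)
open Literature.MathematicalPhysics.QuantumFieldTheory.Balaban1983to89.B9Ineq347 (ScaleTransfer)
open Literature.MathematicalPhysics.QuantumFieldTheory.Balaban1983to89.B9Eq39Adjoint (R R_zero R_smul R_add R_sub R_neg R_inv_R R_R_inv covD covDstar fluct)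
open Literature.MathematicalPhysics.QuantumFieldTheory.Balaban1983to89.B9Eq352DivFormLetters (conj conj_mul conj_sub conj_neg gradLetterF_apply gradLetterB_apply)
open Literature.MathematicalPhysics.QuantumFieldTheory.Balaban1983to89.B9Eq352GradLetters (diffLetter diffLetter_inl diffLetter_inr conj_add conj_finset_sum)
open Literature.MathematicalPhysics.QuantumFieldTheory.Balaban1983to89.B6KLevelCensusIndexV1 (KIdx kGeo)
open Literature.MathematicalPhysics.QuantumFieldTheory.Balaban1983to89.B6Cover236MultiLevelBlocks (cubes)
open Literature.MathematicalPhysics.QuantumFieldTheory.Balaban1983to89.B6GlobalChartV1 (PV boxEquiv)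
open Literature.MathematicalPhysics.QuantumFieldTheory.Balaban1983to89.B9BackgroundsKLevelV1 (shiftsV1)
open Literature.MathematicalPhysics.QuantumFieldTheory.Balaban1983to89.B6Geom246MultiLevelBox (blkOf)
open Literature.MathematicalPhysics.QuantumFieldTheory.Balaban1983to89.B6Ineq2142KLevelV1 (β)
open Literature.MathematicalPhysics.QuantumFieldTheory.Balaban1983to89.B9GeoNormsKLevelV1 (geo9K geo9K_dist_nonneg)
open Literature.MathematicalPhysics.QuantumFieldTheory.Balaban1983to89.B9FromB6 (EBlock decay_mono)
open Literature.MathematicalPhysics.QuantumFieldTheory.Balaban1983to89.B9Eq360DeltaPrimeAY (AfldY)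
open Literature.MathematicalPhysics.QuantumFieldTheory.Balaban1983to89.B9Eq360DeltaPrimeACubeY (blkCubeY)
open Literature.MathematicalPhysics.QuantumFieldTheory.Balaban1983to89.B9CubeLettersOpsL0 (deltaPrimeACubeY GpCubeY)
open Literature.MathematicalPhysics.QuantumFieldTheory.Balaban1983to89.B9CubeLettersBondOpsL0 (BlkCubeY)
open Literature.MathematicalPhysics.QuantumFieldTheory.Balaban1983to89.B9CubeGeometryInputs (geoCK geoCK_len_pos geoCK_eta geoCK_eta_pos RM1 N1 hST_geoCK)
open Literature.MathematicalPhysics.QuantumFieldTheory.Balaban1983to89.B9CubeSequence408 (NearH)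
open Literature.MathematicalPhysics.QuantumFieldTheory.Balaban1983to89.B9CubeLettersInvReadings (kernelFamilySInv cdS_conj cdsS_conj lapS_conj)
open Literature.MathematicalPhysics.QuantumFieldTheory.Balaban1983to89.B9CubeLettersInvWriteDict (eBlock_kernelFamilySInv_of_hasMajorant)
open Literature.MathematicalPhysics.QuantumFieldTheory.Balaban1983to89.B9Thm37CubeCoverCommutators (cutMulY cutMulY_apply cdS_cutMulY_apply cutCommY_apply
  cutCommY_lapSL_apply)
open Literature.MathematicalPhysics.QuantumFieldTheory.Balaban1983to89.B9Cor35GpCubeInputsAtOne (hasMajorant_neg)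
open Literature.MathematicalPhysics.QuantumFieldTheory.Balaban1983to89.B9Cor36CubeCutoffs (SC NearC chiY chiTY locCfgY locCfgY_apply one_le_SC nine_le_SC
  nearC_of_chiY_ne_zero nearC_shiftY nearC_shiftY_symm chiTY_eq_one_of_nearC fluct_cutFldY_of_eq_one abs_chiY_le_one)
open Literature.MathematicalPhysics.QuantumFieldTheory.Balaban1983to89.B9Cor36GpCubeLocLetter (locLetterY locLetterY_def)
open Literature.MathematicalPhysics.QuantumFieldTheory.Balaban1983to89.B9Cor36GpCubeExtAtV (GpVK)
open Literature.MathematicalPhysics.QuantumFieldTheory.Balaban1983to89.B9Cor36SiteSandwichTransfer (hasMajorant_conj_site_sandwich_decay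
  hasMajorant_conj_site_sandwich_decay_src)
open Literature.MathematicalPhysics.QuantumFieldTheory.Balaban1983to89.B9Cor36GpCubeEntriesAtV (gp_cube_entries_at_locCfg)
open Literature.MathematicalPhysics.QuantumFieldTheory.Balaban1983to89.B9Cor36CutoffSecondDiff (chiY_weights nearH_of_chiY_ne_zero₃)
open Literature.MathematicalPhysics.QuantumFieldTheory.Balaban1983to89.Node00 (SiteY BlkY IBondY CfgY GaugeY SiteParY toKT shiftY gaugeY gSiteY parSymY UboxY
  conjY conjY_apply cdS cdsS lapS lapSL lapSL_apply etaS boxEquiv_symm_shiftY)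

variable {d ℓ : ℕ} {hd : 1 ≤ d + 1} {hL : Odd (ℓ + 1) ∧ 1 < ℓ + 1} {b₀ b₁ : ℝ}
variable {𝔸 : Type} [NormedRing 𝔸] [NormedAlgebra ℂ 𝔸] [CompleteSpace 𝔸]
variable {ι : Type} [Fintype ι]

/-! ## §1  Pointwise transport-and-localise: (3.31) through `R(u)⁻¹`, the bond variable read is that of `Ṽ_□` -/

section Pointwise

variable (i : KIdx d ℓ hd hL b₀ b₁)

omit [CompleteSpace 𝔸] in
/-- `R(γ)R(γ)⁻¹Ψ = Ψ`. [cite: Balaban1985BackgroundPropagators, (3.28) p.395, bookkeeping] -/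
theorem conjY_conjY_inv (γ : SiteY i → 𝔸ˣ) (Ψ : SiteY i → 𝔸) : conjY γ (conjY γ⁻¹ Ψ) = Ψ := by
  funext z; rw [conjY_apply, conjY_apply, Pi.inv_apply, R_R_inv]

omit [CompleteSpace 𝔸] in
/-- `(R(γ)⁻¹Ψ)(z) = R(γ(z))⁻¹Ψ(z)`. [cite: Balaban1985BackgroundPropagators, (3.28) p.395, bookkeeping] -/
theorem conjY_inv_apply' (γ : SiteY i → 𝔸ˣ) (Ψ : SiteY i → 𝔸) (z : SiteY i) : conjY γ⁻¹ Ψ z = R (γ z)⁻¹ (Ψ z) := by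
  rw [conjY_apply, Pi.inv_apply]

/-- (3.3) on the site carrier, unfolded. [cite: Balaban1985BackgroundPropagators, (3.3) p.390, bookkeeping] -/
theorem cdS_eq (U : CfgY 𝔸 i) (μ : Fin (d + 1)) (Φ : SiteY i → 𝔸) (z : SiteY i) :
    cdS i U μ Φ z = R (UboxY i U μ z) (Φ (shiftY i μ z)) - Φ z := rfl

/-- (3.8) on the site carrier, unfolded. [cite: Balaban1985BackgroundPropagators, (3.8) p.392, bookkeeping] -/
theorem cdsS_eq (U : CfgY 𝔸 i) (μ : Fin (d + 1)) (Φ : SiteY i → 𝔸) (z : SiteY i) :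
    cdsS i U μ Φ z = R (UboxY i U μ ((shiftY i μ).symm z))⁻¹ (Φ ((shiftY i μ).symm z)) - Φ z := rfl

/-- (3.23) on the site carrier, unfolded. [cite: Balaban1985BackgroundPropagators, (3.23) p.394, bookkeeping] -/
theorem lapS_eq (U : CfgY 𝔸 i) (Φ : SiteY i → 𝔸) (z : SiteY i) : lapS i U Φ z = ∑ μ, cdsS i U μ (cdS i U μ Φ) z := rfl

/-- `(∇_{U,μ}Φ)(z)` depends on `U` only through the bond variable `U_μ(z)`. [cite: Balaban1985BackgroundPropagators, (3.3) p.390, p.410 L14–15] -/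
theorem cdS_congr_pt {W V : CfgY 𝔸 i} {μ : Fin (d + 1)} {z : SiteY i} (h : UboxY i W μ z = UboxY i V μ z) (Φ : SiteY i → 𝔸) :
    cdS i W μ Φ z = cdS i V μ Φ z := by
  rw [cdS_eq, cdS_eq, h]

/-- `(∇*_{U,μ}Φ)(z)` depends on `U` only through `U_μ(z − e_μ)`. [cite: Balaban1985BackgroundPropagators, (3.8) p.392, p.410 L14–15] -/
theorem cdsS_congr_pt {W V : CfgY 𝔸 i} {μ : Fin (d + 1)} {z : SiteY i}
    (h : UboxY i W μ ((shiftY i μ).symm z) = UboxY i V μ ((shiftY i μ).symm z)) (Φ : SiteY i → 𝔸) : cdsS i W μ Φ z = cdsS i V μ Φ z := by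
  rw [cdsS_eq, cdsS_eq, h]

/-- `(Δ_UΦ)(z)` depends on `U` only through `U_ν(z)`, `U_ν(z − e_ν)`, all `ν`. [cite: Balaban1985BackgroundPropagators, (3.23) p.394, p.410 L14–15] -/
theorem lapS_congr_pt {W V : CfgY 𝔸 i} {z : SiteY i}
    (h : ∀ ν, UboxY i W ν z = UboxY i V ν z ∧ UboxY i W ν ((shiftY i ν).symm z) = UboxY i V ν ((shiftY i ν).symm z)) (Φ : SiteY i → 𝔸) :
    lapS i W Φ z = lapS i V Φ z := by
  simp only [lapS_eq, cdsS_eq, cdS_eq, Equiv.apply_symm_apply]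
  refine Finset.sum_congr rfl fun ν _ => ?_
  rw [(h ν).1, (h ν).2]

/-- ★ **FORWARD TRANSPORT-AND-LOCALISE**: where `U^u_μ(z) = Ṽ_μ(z)`, `R(U_μ(z))(R(u)⁻¹Ψ)(z + e_μ) = R(u(z))⁻¹[(∇_{Ṽ,μ}Ψ)(z) + Ψ(z)]` ((3.31):
`∇_{U^u}R(u) = R(u)∇_U`). [cite: Balaban1985BackgroundPropagators, (3.31) p.395, Cor. 3.6 p.408 («gauge invariant»), p.410 L14–15] -/
theorem transport_fwd (g : GaugeY 𝔸 i) (U V : CfgY 𝔸 i) {μ : Fin (d + 1)} {z : SiteY i}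
    (hz : UboxY i (gaugeY i g U) μ z = UboxY i V μ z) (Ψ : SiteY i → 𝔸) :
    R (UboxY i U μ z) (conjY (gSiteY i g)⁻¹ Ψ (shiftY i μ z)) = R (gSiteY i g z)⁻¹ (cdS i V μ Ψ z) + R (gSiteY i g z)⁻¹ (Ψ z) := by
  have hc := congrFun (cdS_conj i g U μ (conjY (gSiteY i g)⁻¹ Ψ)) z
  rw [conjY_conjY_inv, conjY_apply, cdS_congr_pt i hz] at hc
  have h1 : cdS i U μ (conjY (gSiteY i g)⁻¹ Ψ) z = R (gSiteY i g z)⁻¹ (cdS i V μ Ψ z) := by rw [hc, R_inv_R]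
  rw [cdS_eq, conjY_inv_apply' i (gSiteY i g) Ψ z, sub_eq_iff_eq_add] at h1
  exact h1

/-- ★ **BACKWARD TRANSPORT-AND-LOCALISE**: where `U^u_μ(z − e_μ) = Ṽ_μ(z − e_μ)`, `R(U_μ(z−e_μ))⁻¹(R(u)⁻¹Ψ)(z − e_μ) = R(u(z))⁻¹[(∇*_{Ṽ,μ}Ψ)(z) + Ψ(z)]`.
[cite: Balaban1985BackgroundPropagators, (3.31) p.395, (3.8) p.392, p.410 L14–15] -/
theorem transport_bwd (g : GaugeY 𝔸 i) (U V : CfgY 𝔸 i) {μ : Fin (d + 1)} {z : SiteY i}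
    (hz : UboxY i (gaugeY i g U) μ ((shiftY i μ).symm z) = UboxY i V μ ((shiftY i μ).symm z)) (Ψ : SiteY i → 𝔸) :
    R (UboxY i U μ ((shiftY i μ).symm z))⁻¹ (conjY (gSiteY i g)⁻¹ Ψ ((shiftY i μ).symm z))
      = R (gSiteY i g z)⁻¹ (cdsS i V μ Ψ z) + R (gSiteY i g z)⁻¹ (Ψ z) := by
  have hc := congrFun (cdsS_conj i g U μ (conjY (gSiteY i g)⁻¹ Ψ)) z
  rw [conjY_conjY_inv, conjY_apply, cdsS_congr_pt i hz] at hc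
  have h1 : cdsS i U μ (conjY (gSiteY i g)⁻¹ Ψ) z = R (gSiteY i g z)⁻¹ (cdsS i V μ Ψ z) := by rw [hc, R_inv_R]
  rw [cdsS_eq, conjY_inv_apply' i (gSiteY i g) Ψ z, sub_eq_iff_eq_add] at h1
  exact h1

/-- ★ **LAPLACIAN TRANSPORT-AND-LOCALISE**: where `U^u` and `Ṽ` agree on the `2(d+1)` bonds at `z`, `(Δ_U R(u)⁻¹Ψ)(z) = R(u(z))⁻¹(Δ_{Ṽ}Ψ)(z)` ((3.31):
`Δ_{U^u}R(u) = R(u)Δ_U`). [cite: Balaban1985BackgroundPropagators, (3.31) p.395, (3.23) p.394, p.410 L14–15] -/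
theorem transport_lap (g : GaugeY 𝔸 i) (U V : CfgY 𝔸 i) {z : SiteY i}
    (hz : ∀ ν, UboxY i (gaugeY i g U) ν z = UboxY i V ν z ∧ UboxY i (gaugeY i g U) ν ((shiftY i ν).symm z) = UboxY i V ν ((shiftY i ν).symm z))
    (Ψ : SiteY i → 𝔸) : lapS i U (conjY (gSiteY i g)⁻¹ Ψ) z = R (gSiteY i g z)⁻¹ (lapS i V Ψ z) := by
  have hc := congrFun (lapS_conj i g U (conjY (gSiteY i g)⁻¹ Ψ)) z
  rw [conjY_conjY_inv, conjY_apply, lapS_congr_pt i hz] at hc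
  rw [hc, R_inv_R]

/-- ★ **BACKWARD TRANSPORT ON THE RIGHT**: `R(u)∇*_{U,μ}(hΛ) = ∇*_{Ṽ,μ}(R(u)hΛ)` as functions, when `U^u_μ(w − e_μ) = Ṽ_μ(w − e_μ)` wherever `h(w − e_μ) ≠ 0`
(elsewhere the transported term vanishes). [cite: Balaban1985BackgroundPropagators, (3.31) p.395, (3.8) p.392, p.410 L14–15] -/
theorem transport_bwd_right (g : GaugeY 𝔸 i) (U V : CfgY 𝔸 i) (μ : Fin (d + 1)) (h : SiteY i → ℝ)
    (hh : ∀ w, h ((shiftY i μ).symm w) ≠ 0 → UboxY i (gaugeY i g U) μ ((shiftY i μ).symm w) = UboxY i V μ ((shiftY i μ).symm w))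
    (Λ : SiteY i → 𝔸) : conjY (gSiteY i g) (cdsS i U μ (cutMulY h Λ)) = cdsS i V μ (conjY (gSiteY i g) (cutMulY h Λ)) := by
  rw [← cdsS_conj]
  funext w
  rw [cdsS_eq, cdsS_eq]
  by_cases hw : h ((shiftY i μ).symm w) = 0
  · simp only [conjY_apply, cutMulY_apply, hw, Complex.ofReal_zero, zero_smul, R_zero]
  · rw [hh w hw]

/-- the backward Leibniz rule pointwise, shifted form: `h(w)(∇*_{U,μ}Λ)(w) = (∇*_{U,μ}(h⁺Λ))(w) + (h(w+e_μ) − h(w))Λ(w)`, `h⁺ = h(· + e_μ)`.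
[cite: Balaban1985BackgroundPropagators, (3.100) p.413, (3.8) p.392] -/
theorem cutMul_cdsS_shift (U : CfgY 𝔸 i) (μ : Fin (d + 1)) (χ : SiteY i → ℝ) (Λ : SiteY i → 𝔸) (w : SiteY i) :
    ((χ w : ℝ) : ℂ) • cdsS i U μ Λ w
      = cdsS i U μ (cutMulY (fun v => χ (shiftY i μ v)) Λ) w + (((χ (shiftY i μ w) - χ w : ℝ)) : ℂ) • Λ w := by
  rw [cdsS_eq, cdsS_eq, cutMulY_apply, cutMulY_apply, Equiv.apply_symm_apply, R_smul, smul_sub, Complex.ofReal_sub, sub_smul]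
  abel

/-- the Leibniz rule for the covariant Laplacian pointwise (n06-l's (3.88) first line, rearranged):
`(Δ_U(χΦ))(z) = χ(z)(Δ_UΦ)(z) − Σ_μ[(χ(z+e_μ) − χ(z))R(U_μ(z))Φ(z+e_μ) + (χ(z−e_μ) − χ(z))R(U_μ(z−e_μ))⁻¹Φ(z−e_μ)]`.
[cite: Balaban1985BackgroundPropagators, (3.88) p.409 (first line), (3.100) p.413] -/
theorem lapS_cutMulY_apply (U : CfgY 𝔸 i) (χ : SiteY i → ℝ) (Φ : SiteY i → 𝔸) (z : SiteY i) :
    lapS i U (cutMulY χ Φ) z = ((χ z : ℝ) : ℂ) • lapS i U Φ z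
      - ∑ μ : Fin (d + 1), ((((χ (shiftY i μ z) - χ z : ℝ)) : ℂ) • R (UboxY i U μ z) (Φ (shiftY i μ z))
          + (((χ ((shiftY i μ).symm z) - χ z : ℝ)) : ℂ) • R (UboxY i U μ ((shiftY i μ).symm z))⁻¹ (Φ ((shiftY i μ).symm z))) := by
  have h := cutCommY_lapSL_apply i U χ Φ z
  rw [cutCommY_apply, lapSL_apply, lapSL_apply] at h
  rw [← h]; abel

/-- `covD` at def-Y's shifts and bond variables IS `cdS`. [cite: Balaban1985BackgroundPropagators, (3.3) p.390, dictionary] -/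
theorem covD_eq_cdS (U : CfgY 𝔸 i) (μ : Fin (d + 1)) (Φ : SiteY i → 𝔸) : covD (shiftY i) (UboxY i U) μ Φ = cdS i U μ Φ := rfl

/-- `covDstar` at def-Y's shifts and bond variables IS `cdsS`. [cite: Balaban1985BackgroundPropagators, (3.8) p.392, dictionary] -/
theorem covDstar_eq_cdsS (U : CfgY 𝔸 i) (μ : Fin (d + 1)) (Φ : SiteY i → 𝔸) : covDstar (shiftY i) (UboxY i U) μ Φ = cdsS i U μ Φ := rfl

/-- the `∇*`-letter applied: `V¹_{inr μ}Λ = −(η⁻¹•∇*_{U,μ}Λ)`. [cite: Balaban1985BackgroundPropagators, (3.8) p.392, bookkeeping] -/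
theorem diffLetter_inr_apply (U : CfgY 𝔸 i) (cc : ℂ) (μ : Fin (d + 1)) (Λ : SiteY i → 𝔸) :
    diffLetter (shiftY i) (UboxY i U) cc (Sum.inr μ) Λ = -(cc • cdsS i U μ Λ) := by
  funext w
  rw [diffLetter_inr, LinearMap.neg_apply, Pi.neg_apply, gradLetterB_apply, Pi.neg_apply, Pi.smul_apply, covDstar_eq_cdsS]

/-- the `∇`-letter applied: `V¹_{inl μ}Λ = η⁻¹•∇_{U,μ}Λ`. [cite: Balaban1985BackgroundPropagators, (3.3) p.390, bookkeeping] -/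
theorem diffLetter_inl_apply (U : CfgY 𝔸 i) (cc : ℂ) (μ : Fin (d + 1)) (Λ : SiteY i → 𝔸) (w : SiteY i) :
    diffLetter (shiftY i) (UboxY i U) cc (Sum.inl μ) Λ w = cc • cdS i U μ Λ w := by
  rw [diffLetter_inl, gradLetterF_apply, covD_eq_cdS]

end Pointwise

/-! ## §2  The letters in `End_ℝ` and the three identities: member derivatives of `η²O_□` as sums of sandwiches of cube letters at `Ṽ_□` -/

section Letters

variable (i : KIdx d ℓ hd hL b₀ b₁) (c : ↥(cubes (toKT i).D.toDomains))

/-- **THE SANDWICH `M_{g₁}R(γ)⁻¹·M·R(γ)M_{g₂}`** in `End_ℝ` (FILE 7b-B's shape). [cite: Balaban1985BackgroundPropagators, (3.87) p.409, Cor. 3.6 p.408, dictionary] -/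
abbrev SandR (γ : SiteY i → 𝔸ˣ) (g₁ : SiteY i → ℝ) (M : Module.End ℝ (SiteY i → 𝔸)) (g₂ : SiteY i → ℝ) : Module.End ℝ (SiteY i → 𝔸) :=
  (cutMulY (𝔸 := 𝔸) g₁).restrictScalars ℝ ∘ₗ (conjY γ⁻¹).restrictScalars ℝ ∘ₗ M ∘ₗ (conjY γ).restrictScalars ℝ ∘ₗ
    (cutMulY (𝔸 := 𝔸) g₂).restrictScalars ℝ

omit [CompleteSpace 𝔸] in
/-- the sandwich applied: `(Sand(g₁, M, g₂)Λ)(z) = g₁(z)•R(γ(z))⁻¹(M(R(γ)(g₂Λ)))(z)`. [cite: Balaban1985BackgroundPropagators, (3.87) p.409, bookkeeping] -/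
theorem sandR_apply (γ : SiteY i → 𝔸ˣ) (g₁ : SiteY i → ℝ) (M : Module.End ℝ (SiteY i → 𝔸)) (g₂ : SiteY i → ℝ) (Λ : SiteY i → 𝔸) (z : SiteY i) :
    SandR i γ g₁ M g₂ Λ z = ((g₁ z : ℝ) : ℂ) • R (γ z)⁻¹ (M (conjY γ (cutMulY g₂ Λ)) z) := by
  simp only [SandR, LinearMap.comp_apply, LinearMap.restrictScalars_apply, cutMulY_apply, conjY_apply, Pi.inv_apply]

/-- **`η²G′_□(Ṽ_□)` IN `End_ℝ`** (so that `conj b (Ginner i □ A) = GpVK b i □ parSymY A` by `rfl`). [cite: Balaban1985BackgroundPropagators, p.409 l.1–5 («G′_□(U)»), Thm 3.4 p.400] -/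
def Ginner (A : AfldY 𝔸 i) : Module.End ℝ (SiteY i → 𝔸) :=
  ((kGeo i).eta ^ 2) • (GpCubeY i c (parSymY i) (locCfgY i c (kGeo i).eta A)).restrictScalars ℝ

/-- `conj b(η²G′_□(Ṽ_□)) = GpVK`. [cite: Balaban1985BackgroundPropagators, p.409 l.1–5, bookkeeping] -/
theorem conj_Ginner (b : Module.Basis ι ℝ 𝔸) (A : AfldY 𝔸 i) : conj b (Ginner i c A) = GpVK b i c (parSymY i) A := rfl

/-- `Ginner` applied. [cite: Balaban1985BackgroundPropagators, p.409 l.1–5, bookkeeping] -/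
theorem Ginner_apply (A : AfldY 𝔸 i) (Φ : SiteY i → 𝔸) (z : SiteY i) :
    Ginner i c A Φ z = ((kGeo i).eta ^ 2 : ℝ) • GpCubeY i c (parSymY i) (locCfgY i c (kGeo i).eta A) Φ z := rfl

/-- `Ginner` commutes with complex scalars (it is `ℂ`-linear). [cite: Balaban1985BackgroundPropagators, p.409 l.1–5, bookkeeping] -/
theorem Ginner_smulC (A : AfldY 𝔸 i) (cc : ℂ) (Φ : SiteY i → 𝔸) : Ginner i c A (cc • Φ) = cc • Ginner i c A Φ := by
  funext z
  rw [Pi.smul_apply, Ginner_apply, Ginner_apply, map_smul, Pi.smul_apply, smul_comm]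

/-- **`η²O_□` IN `End_ℝ`**: the member's U-constant letter of design (R), `Sand(χ_□, η²G′_□(Ṽ_□), χ_□)` with `γ = u` read on the box chart.
[cite: Balaban1985BackgroundPropagators, Cor. 3.6 p.408, (3.87) p.409] -/
def Gmem (g : GaugeY 𝔸 i) (A : AfldY 𝔸 i) : Module.End ℝ (SiteY i → 𝔸) := SandR i (gSiteY i g) (chiY i c) (Ginner i c A) (chiY i c)

/-- ★ `Gmem = η²•O_□` (the writer's binder `hG`). [cite: Balaban1985BackgroundPropagators, Cor. 3.6 p.408, (3.87) p.409] -/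
theorem Gmem_apply (g : GaugeY 𝔸 i) (A : AfldY 𝔸 i) (Λ : SiteY i → 𝔸) :
    Gmem i c g A Λ = ((kGeo i).eta ^ 2) • locLetterY i c (parSymY i) g (chiY i c) (locCfgY i c (kGeo i).eta A) Λ := by
  funext z
  rw [Gmem, sandR_apply, Pi.smul_apply, locLetterY_def]
  simp only [Module.End.mul_apply, cutMulY_apply, conjY_apply, Pi.inv_apply, Ginner_apply]
  rw [← Complex.coe_smul, ← Complex.coe_smul, R_smul]
  exact smul_comm _ _ _

/-- `Gmem` applied to a function, as a cut-off of a rotated function. [cite: Balaban1985BackgroundPropagators, (3.87) p.409, bookkeeping] -/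
theorem Gmem_apply_fun (g : GaugeY 𝔸 i) (A : AfldY 𝔸 i) (Λ : SiteY i → 𝔸) :
    Gmem i c g A Λ = cutMulY (chiY i c) (conjY (gSiteY i g)⁻¹ (Ginner i c A (conjY (gSiteY i g) (cutMulY (chiY i c) Λ)))) := rfl

/-- **`η⁻²Δ_V` IN `End_ℝ`** (the writer's `L` at `V = U`; FILE 7b-C's Laplacian letter at `V = Ṽ_□`). [cite: Balaban1985BackgroundPropagators, (3.23) p.394, (3.42) p.397] -/
def Lscaled (V : CfgY 𝔸 i) : Module.End ℝ (SiteY i → 𝔸) := (((kGeo i).eta ^ 2)⁻¹ : ℝ) • (lapSL i V).restrictScalars ℝ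

/-- `Lscaled` applied. [cite: Balaban1985BackgroundPropagators, (3.23) p.394, bookkeeping] -/
theorem Lscaled_apply (V : CfgY 𝔸 i) (Λ : SiteY i → 𝔸) : Lscaled i V Λ = (((kGeo i).eta ^ 2)⁻¹ : ℝ) • lapS i V Λ := rfl

variable (g : GaugeY 𝔸 i) (U : CfgY 𝔸 i) (A : AfldY 𝔸 i)

/-- ★★ **THE `∇`-ENTRY**: `(η⁻¹∇_{U,μ})(η²O_□) = Sand(χ⁺, (η⁻¹∇_{Ṽ,μ})(η²G′), χ) + Sand(η⁻¹∂⁺_μχ, η²G′, χ)`, `χ⁺ = χ(· + e_μ)`, `∂⁺_μχ = χ⁺ − χ` —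
Leibniz (3.100), covariance (3.31), and `U^u = Ṽ` on the bonds based at the points of `N ⊇ supp χ⁺`.
[cite: Balaban1985BackgroundPropagators, (3.100) p.413, (3.31) p.395, Cor. 3.6 p.408, p.410 L14–15] -/
theorem diffLetter_inl_mul_Gmem {N : SiteY i → Prop}
    (hN : ∀ (μ : Fin (d + 1)) (z : SiteY i), (chiY i c z ≠ 0 ∨ chiY i c (shiftY i μ z) ≠ 0 ∨ chiY i c ((shiftY i μ).symm z) ≠ 0) → N z)
    (hAG : ∀ (μ : Fin (d + 1)) (w : SiteY i), N w →
      UboxY i (gaugeY i g U) μ w = UboxY i (locCfgY i c (kGeo i).eta A) μ w ∧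
      UboxY i (gaugeY i g U) μ ((shiftY i μ).symm w) = UboxY i (locCfgY i c (kGeo i).eta A) μ ((shiftY i μ).symm w))
    (μ : Fin (d + 1)) :
    diffLetter (shiftY i) (UboxY i U) ((((kGeo i).eta : ℂ))⁻¹) (Sum.inl μ) * Gmem i c g A
      = SandR i (gSiteY i g) (fun z => chiY i c (shiftY i μ z))
          (diffLetter (shiftY i) (UboxY i (locCfgY i c (kGeo i).eta A)) ((((kGeo i).eta : ℂ))⁻¹) (Sum.inl μ) * Ginner i c A) (chiY i c)
        + SandR i (gSiteY i g) (fun z => ((kGeo i).eta)⁻¹ * (chiY i c (shiftY i μ z) - chiY i c z)) (Ginner i c A) (chiY i c) := by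
  refine LinearMap.ext fun Λ => funext fun z => ?_
  set Ψ : SiteY i → 𝔸 := Ginner i c A (conjY (gSiteY i g) (cutMulY (chiY i c) Λ)) with hΨ
  rw [Module.End.mul_apply, Gmem_apply_fun, diffLetter_inl_apply, LinearMap.add_apply, Pi.add_apply, sandR_apply, sandR_apply,
    Module.End.mul_apply, diffLetter_inl_apply, cdS_cutMulY_apply, conjY_inv_apply' i (gSiteY i g) Ψ z, R_smul]
  push_cast
  by_cases h0 : chiY i c (shiftY i μ z) = 0
  · rw [h0]; push_cast; module
  · rw [transport_fwd i g U _ (hAG μ z (hN μ z (Or.inr (Or.inl h0)))).1 Ψ]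
    module

/-- ★★ **THE `∇*`-ENTRY**: `(η²O_□)(−η⁻¹∇*_{U,μ}) = Sand(χ, η²G′(−η⁻¹∇*_{Ṽ,μ}), χ⁺) + Sand(χ, η²G′, −η⁻¹∂⁺_μχ)` — the shifted backward Leibniz rule
`χ∇* = ∇*χ⁺ + ∂⁺χ`, covariance (3.31) on the right, and `U^u = Ṽ` on the bonds based at `w − e_μ`, `w ∈ N ⊇ supp χ`.
[cite: Balaban1985BackgroundPropagators, (3.100) p.413, (3.8) p.392, (3.31) p.395, Cor. 3.6 p.408, p.410 L14–15] -/
theorem Gmem_mul_diffLetter_inr {N : SiteY i → Prop}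
    (hN : ∀ (μ : Fin (d + 1)) (z : SiteY i), (chiY i c z ≠ 0 ∨ chiY i c (shiftY i μ z) ≠ 0 ∨ chiY i c ((shiftY i μ).symm z) ≠ 0) → N z)
    (hAG : ∀ (μ : Fin (d + 1)) (w : SiteY i), N w →
      UboxY i (gaugeY i g U) μ w = UboxY i (locCfgY i c (kGeo i).eta A) μ w ∧
      UboxY i (gaugeY i g U) μ ((shiftY i μ).symm w) = UboxY i (locCfgY i c (kGeo i).eta A) μ ((shiftY i μ).symm w))
    (μ : Fin (d + 1)) :
    Gmem i c g A * diffLetter (shiftY i) (UboxY i U) ((((kGeo i).eta : ℂ))⁻¹) (Sum.inr μ)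
      = SandR i (gSiteY i g) (chiY i c)
          (Ginner i c A * diffLetter (shiftY i) (UboxY i (locCfgY i c (kGeo i).eta A)) ((((kGeo i).eta : ℂ))⁻¹) (Sum.inr μ))
          (fun z => chiY i c (shiftY i μ z))
        + SandR i (gSiteY i g) (chiY i c) (Ginner i c A) (fun z => -(((kGeo i).eta)⁻¹ * (chiY i c (shiftY i μ z) - chiY i c z))) := by
  -- the function identity `R(u)(χ∇*_Uλ) = ∇*_{Ṽ}(R(u)χ⁺λ) + R(u)(∂⁺χ λ)`
  have FI : ∀ Λ : SiteY i → 𝔸, conjY (gSiteY i g) (cutMulY (chiY i c) (cdsS i U μ Λ))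
      = cdsS i (locCfgY i c (kGeo i).eta A) μ (conjY (gSiteY i g) (cutMulY (fun v => chiY i c (shiftY i μ v)) Λ))
        + conjY (gSiteY i g) (cutMulY (fun v => chiY i c (shiftY i μ v) - chiY i c v) Λ) := by
    intro Λ
    have hR := transport_bwd_right i g U (locCfgY i c (kGeo i).eta A) μ (fun v => chiY i c (shiftY i μ v))
      (fun w hw => (hAG μ w (hN μ w (Or.inl ?_))).2) Λ
    · funext w
      rw [Pi.add_apply, ← hR, conjY_apply, cutMulY_apply, cutMul_cdsS_shift, R_add, R_smul, conjY_apply, conjY_apply, cutMulY_apply, R_smul]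
    · rwa [Equiv.apply_symm_apply] at hw
  -- the real multiplier `−η⁻¹∂⁺χ` as a complex multiple of `∂⁺χ`
  have hmul : ∀ Λ : SiteY i → 𝔸, cutMulY (𝔸 := 𝔸) (fun z => -(((kGeo i).eta)⁻¹ * (chiY i c (shiftY i μ z) - chiY i c z))) Λ
      = -(((((kGeo i).eta : ℂ))⁻¹) • cutMulY (fun v => chiY i c (shiftY i μ v) - chiY i c v) Λ) := by
    intro Λ; funext v
    rw [Pi.neg_apply, Pi.smul_apply, cutMulY_apply, cutMulY_apply, smul_smul, ← neg_smul]
    congr 1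
    simp only [Complex.ofReal_neg, Complex.ofReal_mul, Complex.ofReal_inv]
  -- the three inner functions, evaluated
  have hLfun : ∀ Λ : SiteY i → 𝔸,
      Ginner i c A (conjY (gSiteY i g) (cutMulY (chiY i c) (diffLetter (shiftY i) (UboxY i U) ((((kGeo i).eta : ℂ))⁻¹) (Sum.inr μ) Λ)))
        = -(((((kGeo i).eta : ℂ))⁻¹) •
            (Ginner i c A (cdsS i (locCfgY i c (kGeo i).eta A) μ (conjY (gSiteY i g) (cutMulY (fun v => chiY i c (shiftY i μ v)) Λ)))
              + Ginner i c A (conjY (gSiteY i g) (cutMulY (fun v => chiY i c (shiftY i μ v) - chiY i c v) Λ)))) := by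
    intro Λ
    rw [diffLetter_inr_apply, map_neg, map_smul, map_neg, map_smul, FI, map_neg, Ginner_smulC, map_add]
  have hT1fun : ∀ Λ : SiteY i → 𝔸,
      Ginner i c A (diffLetter (shiftY i) (UboxY i (locCfgY i c (kGeo i).eta A)) ((((kGeo i).eta : ℂ))⁻¹) (Sum.inr μ)
          (conjY (gSiteY i g) (cutMulY (fun v => chiY i c (shiftY i μ v)) Λ)))
        = -(((((kGeo i).eta : ℂ))⁻¹) •
            Ginner i c A (cdsS i (locCfgY i c (kGeo i).eta A) μ (conjY (gSiteY i g) (cutMulY (fun v => chiY i c (shiftY i μ v)) Λ)))) := by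
    intro Λ; rw [diffLetter_inr_apply, map_neg, Ginner_smulC]
  have hT2fun : ∀ Λ : SiteY i → 𝔸,
      Ginner i c A (conjY (gSiteY i g) (cutMulY (fun z => -(((kGeo i).eta)⁻¹ * (chiY i c (shiftY i μ z) - chiY i c z))) Λ))
        = -(((((kGeo i).eta : ℂ))⁻¹) • Ginner i c A (conjY (gSiteY i g) (cutMulY (fun v => chiY i c (shiftY i μ v) - chiY i c v) Λ))) := by
    intro Λ; rw [hmul, map_neg, map_smul, map_neg, Ginner_smulC]
  refine LinearMap.ext fun Λ => funext fun z => ?_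
  rw [Module.End.mul_apply, Gmem_apply_fun, cutMulY_apply, conjY_inv_apply', hLfun, LinearMap.add_apply, Pi.add_apply, sandR_apply, sandR_apply,
    Module.End.mul_apply, hT1fun, hT2fun]
  simp only [Pi.neg_apply, Pi.smul_apply, Pi.add_apply, R_neg, R_smul, R_add, smul_add, smul_neg]
  abel

/-- ★★ **THE LAPLACIAN ENTRY**: `η⁻²Δ_U(η²O_□) = Sand(χ, (η⁻²Δ_{Ṽ})(η²G′), χ) − Σ_μ [Sand(η⁻¹∂⁺_μχ, (η⁻¹∇_{Ṽ,μ})(η²G′), χ)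
+ Sand(−η⁻¹∂⁻_μχ, (−η⁻¹∇*_{Ṽ,μ})(η²G′), χ) + Sand(η⁻²∂_μ∂*_μχ, η²G′, χ)]`, `∂⁻_μχ = χ(· − e_μ) − χ`, `∂_μ∂*_μχ = χ(· + e_μ) − 2χ + χ(· − e_μ)` — the (3.88)
first line with the second-order part kept per direction (so that only `|Δh| ≤ O(1)(MLʲη)⁻²` is spent against `G′` itself), covariance (3.31) and the
agreement on the bonds based at `z` and `z − e_μ`, `z ∈ N`. [cite: Balaban1985BackgroundPropagators, (3.88)–(3.89) p.409, (3.100) p.413, (3.31) p.395, p.410 L14–15; Balaban1984PropagatorsII, (2.39)–(2.44) pp.229–230] -/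
theorem Lscaled_mul_Gmem {N : SiteY i → Prop}
    (hN : ∀ (μ : Fin (d + 1)) (z : SiteY i), (chiY i c z ≠ 0 ∨ chiY i c (shiftY i μ z) ≠ 0 ∨ chiY i c ((shiftY i μ).symm z) ≠ 0) → N z)
    (hAG : ∀ (μ : Fin (d + 1)) (w : SiteY i), N w →
      UboxY i (gaugeY i g U) μ w = UboxY i (locCfgY i c (kGeo i).eta A) μ w ∧
      UboxY i (gaugeY i g U) μ ((shiftY i μ).symm w) = UboxY i (locCfgY i c (kGeo i).eta A) μ ((shiftY i μ).symm w)) :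
    Lscaled i U * Gmem i c g A
      = SandR i (gSiteY i g) (chiY i c) (Lscaled i (locCfgY i c (kGeo i).eta A) * Ginner i c A) (chiY i c)
        - ∑ μ : Fin (d + 1),
          (SandR i (gSiteY i g) (fun z => ((kGeo i).eta)⁻¹ * (chiY i c (shiftY i μ z) - chiY i c z))
              (diffLetter (shiftY i) (UboxY i (locCfgY i c (kGeo i).eta A)) ((((kGeo i).eta : ℂ))⁻¹) (Sum.inl μ) * Ginner i c A) (chiY i c)
            + SandR i (gSiteY i g) (fun z => -(((kGeo i).eta)⁻¹ * (chiY i c ((shiftY i μ).symm z) - chiY i c z)))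
              (diffLetter (shiftY i) (UboxY i (locCfgY i c (kGeo i).eta A)) ((((kGeo i).eta : ℂ))⁻¹) (Sum.inr μ) * Ginner i c A) (chiY i c)
            + SandR i (gSiteY i g)
              (fun z => ((kGeo i).eta ^ 2)⁻¹ * (chiY i c (shiftY i μ z) - 2 * chiY i c z + chiY i c ((shiftY i μ).symm z)))
              (Ginner i c A) (chiY i c)) := by
  refine LinearMap.ext fun Λ => funext fun z => ?_
  rw [Module.End.mul_apply, Gmem_apply_fun, Lscaled_apply, Pi.smul_apply, lapS_cutMulY_apply, LinearMap.sub_apply, Pi.sub_apply, sandR_apply,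
    Module.End.mul_apply, Lscaled_apply, Pi.smul_apply, LinearMap.sum_apply, Finset.sum_apply, smul_sub, Finset.smul_sum]
  simp only [LinearMap.add_apply, Pi.add_apply, sandR_apply, Module.End.mul_apply, diffLetter_inl_apply, diffLetter_inr_apply, Pi.neg_apply,
    Pi.smul_apply]
  generalize Ginner i c A (conjY (gSiteY i g) (cutMulY (chiY i c) Λ)) = Ψ
  congr 1
  · -- the main term `η⁻²χ(z)(Δ_U R(u)⁻¹Ψ)(z) = χ(z)R(u(z))⁻¹ η⁻²(Δ_{Ṽ}Ψ)(z)`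
    by_cases h0 : chiY i c z = 0
    · simp only [h0, Complex.ofReal_zero, zero_smul, smul_zero]
    · rw [transport_lap i g U _ (fun ν => hAG ν z (hN ν z (Or.inl h0))) Ψ, ← Complex.coe_smul, ← Complex.coe_smul, R_smul, smul_comm]
  · refine Finset.sum_congr rfl fun μ _ => ?_
    -- forward piece
    have hA : ((((kGeo i).eta ^ 2)⁻¹ : ℝ)) • ((((chiY i c (shiftY i μ z) - chiY i c z : ℝ)) : ℂ) •
          R (UboxY i U μ z) (conjY (gSiteY i g)⁻¹ Ψ (shiftY i μ z)))
        = (((((kGeo i).eta)⁻¹ * (chiY i c (shiftY i μ z) - chiY i c z) : ℝ)) : ℂ) •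
            R (gSiteY i g z)⁻¹ ((((kGeo i).eta : ℂ))⁻¹ • cdS i (locCfgY i c (kGeo i).eta A) μ Ψ z)
          + (((((kGeo i).eta ^ 2)⁻¹ * (chiY i c (shiftY i μ z) - chiY i c z) : ℝ)) : ℂ) • R (gSiteY i g z)⁻¹ (Ψ z) := by
      by_cases h1 : chiY i c z = 0 ∧ chiY i c (shiftY i μ z) = 0
      · rw [h1.1, h1.2]; simp
      · have hor : chiY i c z ≠ 0 ∨ chiY i c (shiftY i μ z) ≠ 0 ∨ chiY i c ((shiftY i μ).symm z) ≠ 0 := by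
          rcases not_and_or.mp h1 with h | h
          · exact Or.inl h
          · exact Or.inr (Or.inl h)
        rw [transport_fwd i g U _ (hAG μ z (hN μ z hor)).1 Ψ, ← Complex.coe_smul, R_smul]
        push_cast
        module
    -- backward piece
    have hB : ((((kGeo i).eta ^ 2)⁻¹ : ℝ)) • ((((chiY i c ((shiftY i μ).symm z) - chiY i c z : ℝ)) : ℂ) •
          R (UboxY i U μ ((shiftY i μ).symm z))⁻¹ (conjY (gSiteY i g)⁻¹ Ψ ((shiftY i μ).symm z)))
        = ((((-(((kGeo i).eta)⁻¹ * (chiY i c ((shiftY i μ).symm z) - chiY i c z))) : ℝ)) : ℂ) •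
            R (gSiteY i g z)⁻¹ (-((((kGeo i).eta : ℂ))⁻¹ • cdsS i (locCfgY i c (kGeo i).eta A) μ Ψ z))
          + (((((kGeo i).eta ^ 2)⁻¹ * (chiY i c ((shiftY i μ).symm z) - chiY i c z) : ℝ)) : ℂ) • R (gSiteY i g z)⁻¹ (Ψ z) := by
      by_cases h1 : chiY i c z = 0 ∧ chiY i c ((shiftY i μ).symm z) = 0
      · rw [h1.1, h1.2]; simp
      · have hor : chiY i c z ≠ 0 ∨ chiY i c (shiftY i μ z) ≠ 0 ∨ chiY i c ((shiftY i μ).symm z) ≠ 0 := by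
          rcases not_and_or.mp h1 with h | h
          · exact Or.inl h
          · exact Or.inr (Or.inr h)
        rw [transport_bwd i g U _ (hAG μ z (hN μ z hor)).2 Ψ, ← Complex.coe_smul, R_neg, R_smul]
        push_cast
        module
    -- the two zeroth-order remainders add up to the second difference
    have hE : (((((kGeo i).eta ^ 2)⁻¹ * (chiY i c (shiftY i μ z) - chiY i c z) : ℝ)) : ℂ) • R (gSiteY i g z)⁻¹ (Ψ z)
          + (((((kGeo i).eta ^ 2)⁻¹ * (chiY i c ((shiftY i μ).symm z) - chiY i c z) : ℝ)) : ℂ) • R (gSiteY i g z)⁻¹ (Ψ z)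
        = (((((kGeo i).eta ^ 2)⁻¹ * (chiY i c (shiftY i μ z) - 2 * chiY i c z + chiY i c ((shiftY i μ).symm z)) : ℝ)) : ℂ) •
            R (gSiteY i g z)⁻¹ (Ψ z) := by
      rw [← add_smul, ← Complex.ofReal_add]
      congr 2
      ring
    rw [smul_add, hA, hB, add_add_add_comm, hE]

end Letters

/-! ## §3  The agreement `U^u = Ṽ_□` near `supp χ_□` from the (3.35) datum -/

section Agreement

variable (i : KIdx d ℓ hd hL b₀ b₁) (c : ↥(cubes (toKT i).D.toDomains))

/-- `z` is within `3.5S_j + 1` of the centre of `β` as soon as `χ_□ ≠ 0` at `z`, `z + e_μ` or `z − e_μ`. [cite: Balaban1985BackgroundPropagators, (3.87) p.409; Balaban1984PropagatorsI, (1.118) p.36] -/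
theorem nearC_of_chiY_ne_zero₃ (μ : Fin (d + 1)) (z : SiteY i)
    (h : chiY i c z ≠ 0 ∨ chiY i c (shiftY i μ z) ≠ 0 ∨ chiY i c ((shiftY i μ).symm z) ≠ 0) : NearC i c (7 * SC i c / 2 + 1) z.1 := by
  rcases h with h | h | h
  · exact (nearC_of_chiY_ne_zero i c h).mono i c (by omega)
  · have h1 := nearC_shiftY_symm i c (nearC_of_chiY_ne_zero i c h) μ
    rwa [Equiv.symm_apply_apply] at h1
  · have h1 := nearC_shiftY i c (nearC_of_chiY_ne_zero i c h) μ
    rwa [Equiv.apply_symm_apply] at h1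

/-- ★ **`U^u = Ṽ_□` ON THE BONDS BASED NEAR □**: if `U^u = e^{iηA}` on the bonds with both ends in `Q ⊇ NearC(4.375S_j + 1)` and `x` charts to within
`r ≤ min(3.75S_j, 4.375S_j)` of the centre of `β`, then `U^u_κ(x) = e^{iη(χ̃_□A)_κ(x)} = Ṽ_□,κ(x)` (`χ̃_□ = 1` there).
[cite: Balaban1985BackgroundPropagators, Cor. 3.6 p.408 («U′ = U^u = e^{iηA}»), p.409 l.1–3, p.410 L14–15] -/
theorem UboxY_gaugeY_eq_locCfgY {g : GaugeY 𝔸 i} {U : CfgY 𝔸 i} {A : AfldY 𝔸 i} {Q : Set (Site (PV d ℓ i.m i.K hd hL) 0)} (η : ℝ) {r : ℤ}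
    (h15 : 4 * r ≤ 15 * SC i c) (h35 : r ≤ 35 * SC i c / 8)
    (hQ : ∀ x : Site (PV d ℓ i.m i.K hd hL) 0, NearC i c (35 * SC i c / 8 + 1) (boxEquiv i.hN x).1 → x ∈ Q)
    (hgA : ∀ (κ : Fin (d + 1)) (x : Site (PV d ℓ i.m i.K hd hL) 0), x ∈ Q → x.shift κ ∈ Q → gaugeY i g U κ x = fluct η A κ x)
    {w : SiteY i} (hw : NearC i c r w.1) (κ : Fin (d + 1)) :
    UboxY i (gaugeY i g U) κ w = UboxY i (locCfgY i c η A) κ w := by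
  show gaugeY i g U κ ((boxEquiv i.hN).symm w) = locCfgY i c η A κ ((boxEquiv i.hN).symm w)
  have hw' : NearC i c r (boxEquiv i.hN ((boxEquiv i.hN).symm w)).1 := by rw [Equiv.apply_symm_apply]; exact hw
  have h1 : chiTY i c (boxEquiv i.hN ((boxEquiv i.hN).symm w)) = 1 := by
    rw [Equiv.apply_symm_apply]; exact chiTY_eq_one_of_nearC i c h15 hw
  rw [locCfgY_apply, fluct_cutFldY_of_eq_one i η A h1]
  refine hgA κ _ (hQ _ (hw'.mono i c (by omega))) (hQ _ ?_)
  have e : boxEquiv i.hN (((boxEquiv i.hN).symm w).shift κ) = shiftY i κ w := by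
    rw [← boxEquiv_symm_shiftY, Equiv.apply_symm_apply]
  rw [e]
  exact (nearC_shiftY i c hw κ).mono i c (by omega)

/-- the agreement binder `hAG` of §2 for `N = NearC(3.5S_j + 1)`: `U^u = Ṽ_□` on the bonds based at `w` and at `w − e_μ`.
[cite: Balaban1985BackgroundPropagators, Cor. 3.6 p.408, p.409 l.1–3, p.410 L14–15] -/
theorem agree_near {g : GaugeY 𝔸 i} {U : CfgY 𝔸 i} {A : AfldY 𝔸 i} {Q : Set (Site (PV d ℓ i.m i.K hd hL) 0)} (η : ℝ)
    (hQ : ∀ x : Site (PV d ℓ i.m i.K hd hL) 0, NearC i c (35 * SC i c / 8 + 1) (boxEquiv i.hN x).1 → x ∈ Q)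
    (hgA : ∀ (κ : Fin (d + 1)) (x : Site (PV d ℓ i.m i.K hd hL) 0), x ∈ Q → x.shift κ ∈ Q → gaugeY i g U κ x = fluct η A κ x)
    (μ : Fin (d + 1)) (w : SiteY i) (hw : NearC i c (7 * SC i c / 2 + 1) w.1) :
    UboxY i (gaugeY i g U) μ w = UboxY i (locCfgY i c η A) μ w ∧
      UboxY i (gaugeY i g U) μ ((shiftY i μ).symm w) = UboxY i (locCfgY i c η A) μ ((shiftY i μ).symm w) := by
  have hS := nine_le_SC i c
  refine ⟨UboxY_gaugeY_eq_locCfgY i c η (r := 7 * SC i c / 2 + 1) (by omega) (by omega) hQ hgA hw μ,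
    UboxY_gaugeY_eq_locCfgY i c η (r := 7 * SC i c / 2 + 2) (by omega) (by omega) hQ hgA ?_ μ⟩
  exact (nearC_shiftY_symm i c hw μ).mono i c (by omega)

end Agreement

/-! ## §4  Assembly: the (3.42)-block `hE` of M5.5 FILE 6 for `O_□`, over the member's geometry -/

section Assembly

/-- transporting a majorant along an equality of operators. [cite: Balaban1984PropagatorsII, (2.52) p.232, bookkeeping] -/
theorem hasMajorant_congr_op {g : B6.Geometry} {X : Type} {blk : X → g.Site} {T T' : Module.End ℝ (X → ℝ)} {K : g.Site → g.Site → ℝ}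
    (hT : HasMajorant (g := g) blk T K) (h : T = T') : HasMajorant (g := g) blk T' K := h ▸ hT

/-- majorants of a finite sum add up. [cite: Balaban1984PropagatorsII, (2.52) p.232 («A summation preserves it also»)] -/
theorem hasMajorant_finset_sum {g : B6.Geometry} {X κ : Type} (blk : X → g.Site) (s : Finset κ) (T : κ → Module.End ℝ (X → ℝ))
    (K : κ → g.Site → g.Site → ℝ) (h : ∀ k ∈ s, HasMajorant (g := g) blk (T k) (K k)) :
    HasMajorant (g := g) blk (∑ k ∈ s, T k) (fun a a' => ∑ k ∈ s, K k a a') := by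
  induction s using Finset.cons_induction with
  | empty => simpa using hasMajorant_zero (g := g) blk
  | cons k s hk ih =>
    rw [Finset.sum_cons]
    exact hasMajorant_mono (g := g) blk
      (hasMajorant_add (g := g) blk (h k (Finset.mem_cons_self _ _)) (ih fun k' hk' => h k' (Finset.mem_cons_of_mem hk')))
      fun a a' => by rw [Finset.sum_cons]

/-- weakening one exponential kernel in constant, weight and rate. [cite: Balaban1984PropagatorsII, (2.54) p.233, bookkeeping] -/
theorem kernel_le {C₁ C w₁ w δ₁ δ t : ℝ} (ht : 0 ≤ t) (hw₁ : 0 ≤ w₁) (h₁ : w₁ ≤ w) (hC₁C : C₁ ≤ C) (hC : 0 ≤ C) (hδ : δ ≤ δ₁) :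
    C₁ * w₁ * Real.exp (-(δ₁ * t)) ≤ C * w * Real.exp (-(δ * t)) := by
  calc C₁ * w₁ * Real.exp (-(δ₁ * t)) ≤ C * w₁ * Real.exp (-(δ₁ * t)) :=
        mul_le_mul_of_nonneg_right (mul_le_mul_of_nonneg_right hC₁C hw₁) (Real.exp_nonneg _)
    _ ≤ C * w * Real.exp (-(δ₁ * t)) := mul_le_mul_of_nonneg_right (mul_le_mul_of_nonneg_left h₁ hC) (Real.exp_nonneg _)
    _ ≤ C * w * Real.exp (-(δ * t)) := mul_le_mul_of_nonneg_left (decay_mono hδ ht) (mul_nonneg hC (hw₁.trans h₁))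

variable (b : Module.Basis ι ℝ 𝔸)

/-- ★★★ **THE (3.42)-BLOCK `hE` OF M5.5 FILE 6 FOR THE CUBE LETTER `O_□` OF DESIGN (R)** (Corollary 3.6 at one cover cube, read at the member):
there are a rate `δ > 0`, a constant `B₀ ≥ 0`, thresholds `M₀, N₀, T₀` and `a₁ > 0` — functions of `d, L, M₂, b` only — such that for every member above
threshold, every cover cube □, every (3.35) datum `(u, A, Q, C, ξ, Λ)` of FILE 4's form (`Q ⊇ NearC(4.375S_j + 1)`, `U^u = e^{iηA}` on the bonds of `Q`,
`|A| ≤ Cξ⁻¹`, `|η⁻¹∂A| ≤ Cξ⁻²` on `Q`, `ξ ≤ 5S_jη`, `L^{j+1}η ≤ Λξ`, `α₁ := max C (C(1+D₁θ))Λ² ≤ min a₁ ¼`), `u` a bi-contraction, `etaS i = η`, and every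
background family through `U`: `Δ′_{a,□}(Ṽ_□)` is invertible AND
`EBlock (kernelFamilySInv i B cfg (fun _ => χ_□R(u)⁻¹G′_□(Ṽ_□)R(u)χ_□) par) B₀ δ U₁` — the four (3.42) entries of `η²O_□` with the MEMBER's derivatives.
[cite: Balaban1985BackgroundPropagators, Cor. 3.6 p.408, (3.87)–(3.89) p.409, p.410 L14–15, Thm 3.1 (3.42) p.397, Thm 3.4 p.400; Balaban1984PropagatorsII, (2.39)–(2.44) pp.229–230, (2.52)–(2.55) p.232] -/
theorem eBlock_locLetterY [NormOneClass 𝔸] [DecidableEq ι] (d ℓ : ℕ) (hℓ : 1 ≤ ℓ) (M₂ : ℝ) (hM₂ : 0 ≤ M₂)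
    (hrepr : ∀ (v : 𝔸) (j : ι), |b.repr v j| ≤ M₂ * ‖v‖) :
    ∃ δ B₀ M₀ T₀ : ℝ, ∃ N₀ : ℕ, 0 < δ ∧ 0 ≤ B₀ ∧ ∃ a₁ : ℝ, 0 < a₁ ∧
    ∀ {hd : 1 ≤ d + 1} {hL : Odd (ℓ + 1) ∧ 1 < ℓ + 1} {b₀ b₁ : ℝ} (i : KIdx d ℓ hd hL b₀ b₁) (c : ↥(cubes (toKT i).D.toDomains)),
      M₀ ≤ ((ℓ : ℝ) + 1) * (toKT i).Mh → N₀ + 1 ≤ (toKT i).R * ((ℓ + 1) * (toKT i).Mh) → T₀ ≤ RM1 i →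
    ∀ (g : GaugeY 𝔸 i) (U : CfgY 𝔸 i) (A : AfldY 𝔸 i) (Q : Set (Site (PV d ℓ i.m i.K hd hL) 0)) (C ξ Λ : ℝ),
      0 ≤ C → 0 < ξ → 1 ≤ Λ → ξ ≤ 5 * (SC i c : ℝ) * (kGeo i).eta → LatticeNorms.scaleLen ((ℓ : ℝ) + 1) (kGeo i).eta (c.1.1 + 1) ≤ Λ * ξ →
      (∀ x : Site (PV d ℓ i.m i.K hd hL) 0, NearC i c (35 * SC i c / 8 + 1) (boxEquiv i.hN x).1 → x ∈ Q) →
      (∀ (κ : Fin (d + 1)) (x : Site (PV d ℓ i.m i.K hd hL) 0), x ∈ Q → x.shift κ ∈ Q → gaugeY i g U κ x = fluct (kGeo i).eta A κ x) →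
      (∀ κ, ∀ x ∈ Q, ‖A κ x‖ ≤ C * ξ⁻¹) →
      (∀ μ ν, ∀ x ∈ Q, ‖(((kGeo i).eta : ℂ)⁻¹) • covD (shiftsV1 (PV d ℓ i.m i.K hd hL)) (fun _ _ => (1 : 𝔸ˣ)) μ (A ν) x‖ ≤ C * (ξ ^ 2)⁻¹) →
      max C (C * (1 + D1 thetaProf)) * Λ ^ 2 ≤ a₁ → max C (C * (1 + D1 thetaProf)) * Λ ^ 2 ≤ 1 / 4 →
      (∀ x, ‖((g x : 𝔸ˣ) : 𝔸)‖ ≤ 1 ∧ ‖(((g x)⁻¹ : 𝔸ˣ) : 𝔸)‖ ≤ 1) →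
    ∀ [Fintype (geo9K i).Site] (ιB : BlkY i → IBondY i) (_ : ∀ s, β i.hN i.D i.hk (ιB s) = s) (Rr : ℝ) (Hp : Prop)
      {B : B9.Backgrounds} (cfg : B.Cfg → CfgY 𝔸 i) (par : SiteParY 𝔸 i) (U₁ : B.Cfg), cfg U₁ = U → etaS i = (kGeo i).eta →
      IsUnit (deltaPrimeACubeY i c (parSymY i) (locCfgY i c (kGeo i).eta A)) ∧
      EBlock (kernelFamilySInv i B cfg (fun _ => locLetterY i c (parSymY i) g (chiY i c) (locCfgY i c (kGeo i).eta A)) par) B₀ δ U₁ := by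
  have hSb : 0 ≤ ∑ j, ‖b j‖ := Finset.sum_nonneg fun _ _ => norm_nonneg _
  have hD1 := D1_nonneg contDiff_thetaProf hasCompactSupport_thetaProf
  have hD2 := D2_nonneg contDiff_thetaProf hasCompactSupport_thetaProf
  obtain ⟨δC, Bf, M₀, T₀, N₀, hδC, hBf, a₁, ha₁, Hc⟩ := gp_cube_entries_at_locCfg b d ℓ hℓ M₂ hM₂ hrepr
  -- the constants: `P = (M₂Σ‖b_j‖)²`, `Λ4 = L⁴`, one constant per writer entry, `Bc` their sum
  obtain ⟨P, hP⟩ : ∃ P : ℝ, P = (M₂ * ∑ j, ‖b j‖) ^ 2 := ⟨_, rfl⟩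
  have hP0 : 0 ≤ P := by rw [hP]; positivity
  obtain ⟨C0, hC0⟩ : ∃ C0 : ℝ, C0 = P * (1 * 1 * Bf) := ⟨_, rfl⟩
  obtain ⟨C1, hC1⟩ : ∃ C1 : ℝ, C1 = P * (1 * 1 * Bf) + P * (D1 thetaProf / 4 * 1 * Bf) := ⟨_, rfl⟩
  obtain ⟨C2, hC2⟩ : ∃ C2 : ℝ, C2 = P * (1 * 1 * Bf) + P * (1 * (D1 thetaProf / 4) * Bf * (((ℓ : ℝ) + 1) ^ 4)) := ⟨_, rfl⟩
  obtain ⟨C3, hC3⟩ : ∃ C3 : ℝ, C3 = P * (1 * 1 * Bf) +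
      ((d : ℝ) + 1) * (P * (D1 thetaProf / 4 * 1 * Bf) + P * (D1 thetaProf / 4 * 1 * Bf) + P * (3 * D2 thetaProf / 16 * 1 * Bf)) := ⟨_, rfl⟩
  have hC00 : 0 ≤ C0 := by rw [hC0]; positivity
  have hC10 : 0 ≤ C1 := by rw [hC1]; positivity
  have hC20 : 0 ≤ C2 := by rw [hC2]; positivity
  have hC30 : 0 ≤ C3 := by rw [hC3]; positivity
  obtain ⟨Bc, hBc⟩ : ∃ Bc : ℝ, Bc = C0 + C1 + C2 + C3 := ⟨_, rfl⟩
  have hBc0 : 0 ≤ Bc := by rw [hBc]; positivity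
  have hc0 : C0 ≤ Bc := by rw [hBc]; linarith
  have hc1 : C1 ≤ Bc := by rw [hBc]; linarith
  have hc2 : C2 ≤ Bc := by rw [hBc]; linarith
  have hc3 : C3 ≤ Bc := by rw [hBc]; linarith
  -- the final rate `δ_f = (1 − 9/5000)δ_C`
  have hδf : (1 - 9 / 5000) * δC ≤ δC := by nlinarith
  have hδf0 : 0 < (1 - 9 / 5000) * δC := by positivity
  refine ⟨(1 - 9 / 5000) * δC, M₂ * (∑ j, ‖b j‖) * Bc, M₀, max T₀ (4 * Real.log ((ℓ : ℝ) + 1) / (9 / 5000 * δC)), N₀, hδf0, by positivity,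
    a₁, ha₁, ?_⟩
  intro hd hL b₀ b₁ i c hM hN hT g U A Q C ξ Λ hC hξ hΛ hξS hΛξ hQ hgA hA hdA hα₁ hα4 hg _ ιB hι Rr Hp B cfg par U₁ hcfg hη
  have hT₀ : T₀ ≤ RM1 i := (le_max_left _ _).trans hT
  have hTS : 4 * Real.log ((ℓ : ℝ) + 1) / (9 / 5000 * δC) ≤ RM1 i := (le_max_right _ _).trans hT
  obtain ⟨hunit, E0, E1, E2, E3⟩ := Hc i c Rr Hp hM hN hT₀ g U A Q C ξ Λ hC hξ hΛ hξS hΛξ hQ hgA hA hdA hα₁ hα4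
  refine ⟨hunit, ?_⟩
  -- the inputs of FILE 7b-B
  have hγ : ∀ (z : SiteY i) (a : 𝔸), ‖R (gSiteY i g z) a‖ ≤ ‖a‖ ∧ ‖R (gSiteY i g z)⁻¹ a‖ ≤ ‖a‖ := fun z a =>
    ⟨B9Eq310Hermitian.norm_R_le (hg _).1 (hg _).2 a, B9Eq310Hermitian.norm_R_inv_le (hg _).1 (hg _).2 a⟩
  have hNz := nearC_of_chiY_ne_zero₃ i c
  have hAG := agree_near i c (kGeo i).eta hQ hgA
  have hST := (hST_geoCK i c hδC hTS (9 / 5000) le_rfl).2.2.1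
  have hl : ∀ a : IBondY i, 0 ≤ (geo9K i).len a := fun a => (B6KLevelCensusIndexV1.len_pos i a).le
  -- the cube entries in the form `conj b (X * Ginner)`, `conj b (Ginner * X)`
  have E0' : HasMajorant (g := toB6 (geoCK i c) Rr Hp) (fun p : SiteY i × ι => blkCubeY i c p.1) (conj b (Ginner i c A))
      (fun a a' => Bf * (geoCK i c).len a ^ 2 * Real.exp (-(δC * (geoCK i c).dist a a'))) := E0
  have E1' : ∀ k : Fin (d + 1) ⊕ Fin (d + 1), HasMajorant (g := toB6 (geoCK i c) Rr Hp) (fun p : SiteY i × ι => blkCubeY i c p.1)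
      (conj b (diffLetter (shiftY i) (UboxY i (locCfgY i c (kGeo i).eta A)) ((((kGeo i).eta : ℂ))⁻¹) k * Ginner i c A))
      (fun a a' => Bf * (geoCK i c).len a ^ 1 * Real.exp (-(δC * (geoCK i c).dist a a'))) := fun k => by
    simpa only [pow_one, B9Eq352DivFormLetters.conj_mul, conj_Ginner] using E1 k
  have E2' : ∀ μ : Fin (d + 1), HasMajorant (g := toB6 (geoCK i c) Rr Hp) (fun p : SiteY i × ι => blkCubeY i c p.1)
      (conj b (Ginner i c A * diffLetter (shiftY i) (UboxY i (locCfgY i c (kGeo i).eta A)) ((((kGeo i).eta : ℂ))⁻¹) (Sum.inr μ)))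
      (fun a a' => Bf * (geoCK i c).len a ^ 1 * Real.exp (-(δC * (geoCK i c).dist a a'))) := fun μ => by
    simpa only [pow_one, B9Eq352DivFormLetters.conj_mul, conj_Ginner] using E2 μ
  have E3' : HasMajorant (g := toB6 (geoCK i c) Rr Hp) (fun p : SiteY i × ι => blkCubeY i c p.1)
      (conj b (Lscaled i (locCfgY i c (kGeo i).eta A) * Ginner i c A))
      (fun a a' => Bf * (geoCK i c).len a ^ 0 * Real.exp (-(δC * (geoCK i c).dist a a'))) := by
    simpa only [pow_zero, B9Eq352DivFormLetters.conj_mul, conj_Ginner, Lscaled] using E3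
  -- the multiplier sizes (FILE 7b-D1) and the supports (`NearH`)
  have hχ : ∀ z : SiteY i, |chiY i c z| ≤ 1 := fun z => (abs_chiY_le_one i c z).1
  have hχ0 : ∀ z : SiteY i, |chiY i c z| * (geoCK i c).len (blkCubeY i c z) ^ 0 ≤ 1 := fun z => by
    rw [pow_zero, mul_one]; exact hχ z
  have hχp : ∀ (μ : Fin (d + 1)) (z : SiteY i), |(fun z => chiY i c (shiftY i μ z)) z| ≤ 1 := fun μ z => (chiY_weights i c μ z).2.1
  have hχp0 : ∀ (μ : Fin (d + 1)) (z : SiteY i), |(fun z => chiY i c (shiftY i μ z)) z| * (geoCK i c).len (blkCubeY i c z) ^ 0 ≤ 1 :=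
    fun μ z => by rw [pow_zero, mul_one]; exact hχp μ z
  have hdp1 : ∀ (μ : Fin (d + 1)) (z : SiteY i),
      |(fun z => ((kGeo i).eta)⁻¹ * (chiY i c (shiftY i μ z) - chiY i c z)) z| * (geoCK i c).len (blkCubeY i c z) ^ 1 ≤ D1 thetaProf / 4 :=
    fun μ z => by rw [pow_one]; exact (chiY_weights i c μ z).2.2.2.1
  have hdn1 : ∀ (μ : Fin (d + 1)) (z : SiteY i),
      |(fun z => -(((kGeo i).eta)⁻¹ * (chiY i c (shiftY i μ z) - chiY i c z))) z| * (geoCK i c).len (blkCubeY i c z) ≤ D1 thetaProf / 4 :=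
    fun μ z => by beta_reduce; rw [abs_neg]; exact (chiY_weights i c μ z).2.2.2.1
  have hdm1 : ∀ (μ : Fin (d + 1)) (z : SiteY i),
      |(fun z => -(((kGeo i).eta)⁻¹ * (chiY i c ((shiftY i μ).symm z) - chiY i c z))) z| * (geoCK i c).len (blkCubeY i c z) ^ 1
        ≤ D1 thetaProf / 4 :=
    fun μ z => by beta_reduce; rw [pow_one, abs_neg]; exact (chiY_weights i c μ z).2.2.2.2.1
  have hdd2 : ∀ (μ : Fin (d + 1)) (z : SiteY i),
      |(fun z => ((kGeo i).eta ^ 2)⁻¹ * (chiY i c (shiftY i μ z) - 2 * chiY i c z + chiY i c ((shiftY i μ).symm z))) z|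
        * (geoCK i c).len (blkCubeY i c z) ^ 2 ≤ 3 * D2 thetaProf / 16 :=
    fun μ z => by beta_reduce; exact (chiY_weights i c μ z).2.2.2.2.2
  have hnχ : ∀ z : SiteY i, chiY i c z ≠ 0 → NearH c z.1 := fun z hz => nearH_of_chiY_ne_zero₃ i c 0 z (Or.inl hz)
  have hnχp : ∀ (μ : Fin (d + 1)) (z : SiteY i), (fun z => chiY i c (shiftY i μ z)) z ≠ 0 → NearH c z.1 := fun μ z hz =>
    nearH_of_chiY_ne_zero₃ i c μ z (Or.inr (Or.inl hz))
  have hndn : ∀ (μ : Fin (d + 1)) (z : SiteY i), (fun z => -(((kGeo i).eta)⁻¹ * (chiY i c (shiftY i μ z) - chiY i c z))) z ≠ 0 → NearH c z.1 := by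
    intro μ z hz
    refine nearH_of_chiY_ne_zero₃ i c μ z ?_
    by_contra hcon
    simp only [not_or, not_ne_iff] at hcon
    exact hz (by beta_reduce; rw [hcon.1, hcon.2.1, sub_self, mul_zero, neg_zero])
  -- (3.42)₁: `η²O_□ = Sand(χ, η²G′, χ)`
  have W0 : HasMajorant (g := toB6 (geo9K i) Rr Hp) (fun p : SiteY i × ι => ιB (blkOf i.D.toDomains p.1)) (conj b (Gmem i c g A))
      (fun a a' => Bc * (geo9K i).len a ^ 2 * Real.exp (-((1 - 9 / 5000) * δC * (geo9K i).dist a a'))) := by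
    have T := hasMajorant_conj_site_sandwich_decay i c b hM₂ hrepr (gSiteY i g) hγ (chiY i c) (chiY i c) (c₁ := 1) (c₂ := 1)
      zero_le_one zero_le_one (m := 0) (n := 2) (by norm_num) hχ0 hχ hnχ ιB hι Rr Hp Rr Hp hBf hδC.le (Ginner i c A) E0'
    refine hasMajorant_mono (g := toB6 (geo9K i) Rr Hp) _ T fun a a' => ?_
    rw [← hP, ← hC0]
    exact kernel_le (geo9K_dist_nonneg i a a') (pow_nonneg (hl a) _) (le_of_eq (by norm_num)) hc0 hBc0 hδf
  -- (3.42)₂: `(η⁻¹∇_{U,μ})(η²O_□)`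
  have W1 : ∀ μ : Fin (d + 1), HasMajorant (g := toB6 (geo9K i) Rr Hp) (fun p : SiteY i × ι => ιB (blkOf i.D.toDomains p.1))
      (conj b (diffLetter (shiftY i) (UboxY i U) ((((kGeo i).eta : ℂ))⁻¹) (Sum.inl μ)) * conj b (Gmem i c g A))
      (fun a a' => Bc * (geo9K i).len a * Real.exp (-((1 - 9 / 5000) * δC * (geo9K i).dist a a'))) := by
    intro μ
    have Ta := hasMajorant_conj_site_sandwich_decay i c b hM₂ hrepr (gSiteY i g) hγ (fun z => chiY i c (shiftY i μ z)) (chiY i c)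
      (c₁ := 1) (c₂ := 1) zero_le_one zero_le_one (m := 0) (n := 1) (by norm_num) (hχp0 μ) hχ hnχ ιB hι Rr Hp Rr Hp hBf hδC.le
      (diffLetter (shiftY i) (UboxY i (locCfgY i c (kGeo i).eta A)) ((((kGeo i).eta : ℂ))⁻¹) (Sum.inl μ) * Ginner i c A) (E1' (Sum.inl μ))
    have Tb := hasMajorant_conj_site_sandwich_decay i c b hM₂ hrepr (gSiteY i g) hγ
      (fun z => ((kGeo i).eta)⁻¹ * (chiY i c (shiftY i μ z) - chiY i c z)) (chiY i c) (c₁ := D1 thetaProf / 4) (c₂ := 1) (by positivity)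
      zero_le_one (m := 1) (n := 2) (by norm_num) (hdp1 μ) hχ hnχ ιB hι Rr Hp Rr Hp hBf hδC.le (Ginner i c A) E0'
    have hs := hasMajorant_congr_op (T' := conj b (diffLetter (shiftY i) (UboxY i U) ((((kGeo i).eta : ℂ))⁻¹) (Sum.inl μ)) * conj b (Gmem i c g A))
      (hasMajorant_add _ Ta Tb) (by rw [← B9Eq352DivFormLetters.conj_mul, diffLetter_inl_mul_Gmem i c g U A hNz hAG μ, conj_add])
    refine hasMajorant_mono (g := toB6 (geo9K i) Rr Hp) _ hs fun a a' => ?_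
    have hd := geo9K_dist_nonneg i a a'
    calc (M₂ * ∑ j, ‖b j‖) ^ 2 * (1 * 1 * Bf) * (geo9K i).len a ^ (1 - 0) * Real.exp (-(δC * (geo9K i).dist a a'))
          + (M₂ * ∑ j, ‖b j‖) ^ 2 * (D1 thetaProf / 4 * 1 * Bf) * (geo9K i).len a ^ (2 - 1) * Real.exp (-(δC * (geo9K i).dist a a'))
        ≤ P * (1 * 1 * Bf) * (geo9K i).len a * Real.exp (-((1 - 9 / 5000) * δC * (geo9K i).dist a a'))
          + P * (D1 thetaProf / 4 * 1 * Bf) * (geo9K i).len a * Real.exp (-((1 - 9 / 5000) * δC * (geo9K i).dist a a')) := by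
          rw [hP]
          exact add_le_add (kernel_le hd (pow_nonneg (hl a) _) (le_of_eq (by norm_num)) le_rfl (by positivity) hδf)
            (kernel_le hd (pow_nonneg (hl a) _) (le_of_eq (by norm_num)) le_rfl (by positivity) hδf)
      _ = C1 * (geo9K i).len a * Real.exp (-((1 - 9 / 5000) * δC * (geo9K i).dist a a')) := by rw [hC1]; ring
      _ ≤ Bc * (geo9K i).len a * Real.exp (-((1 - 9 / 5000) * δC * (geo9K i).dist a a')) :=
          mul_le_mul_of_nonneg_right (mul_le_mul_of_nonneg_right hc1 (hl a)) (Real.exp_nonneg _)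
  -- (3.42)₃: `(η²O_□)(−η⁻¹∇*_{U,μ})`
  have W2 : ∀ μ : Fin (d + 1), HasMajorant (g := toB6 (geo9K i) Rr Hp) (fun p : SiteY i × ι => ιB (blkOf i.D.toDomains p.1))
      (conj b (Gmem i c g A) * conj b (diffLetter (shiftY i) (UboxY i U) ((((kGeo i).eta : ℂ))⁻¹) (Sum.inr μ)))
      (fun a a' => Bc * (geo9K i).len a * Real.exp (-((1 - 9 / 5000) * δC * (geo9K i).dist a a'))) := by
    intro μ
    have Ta := hasMajorant_conj_site_sandwich_decay i c b hM₂ hrepr (gSiteY i g) hγ (chiY i c) (fun z => chiY i c (shiftY i μ z))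
      (c₁ := 1) (c₂ := 1) zero_le_one zero_le_one (m := 0) (n := 1) (by norm_num) hχ0 (hχp μ) (hnχp μ) ιB hι Rr Hp Rr Hp hBf hδC.le
      (Ginner i c A * diffLetter (shiftY i) (UboxY i (locCfgY i c (kGeo i).eta A)) ((((kGeo i).eta : ℂ))⁻¹) (Sum.inr μ)) (E2' μ)
    have Tb := hasMajorant_conj_site_sandwich_decay_src i c b hM₂ hrepr (gSiteY i g) hγ (chiY i c)
      (fun z => -(((kGeo i).eta)⁻¹ * (chiY i c (shiftY i μ z) - chiY i c z))) (c₁ := 1) (c₂ := D1 thetaProf / 4) zero_le_one (by positivity)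
      hχ (hdn1 μ) (hndn μ) ιB hι Rr Hp Rr Hp hBf hδC.le (by norm_num : (9 : ℝ) / 5000 ≤ 1) (by positivity : (0 : ℝ) ≤ ((ℓ : ℝ) + 1) ^ 4)
      hST (Ginner i c A) E0'
    have hs := hasMajorant_congr_op (T' := conj b (Gmem i c g A) * conj b (diffLetter (shiftY i) (UboxY i U) ((((kGeo i).eta : ℂ))⁻¹) (Sum.inr μ)))
      (hasMajorant_add _ Ta Tb) (by rw [← B9Eq352DivFormLetters.conj_mul, Gmem_mul_diffLetter_inr i c g U A hNz hAG μ, conj_add])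
    refine hasMajorant_mono (g := toB6 (geo9K i) Rr Hp) _ hs fun a a' => ?_
    have hd := geo9K_dist_nonneg i a a'
    calc (M₂ * ∑ j, ‖b j‖) ^ 2 * (1 * 1 * Bf) * (geo9K i).len a ^ (1 - 0) * Real.exp (-(δC * (geo9K i).dist a a'))
          + (M₂ * ∑ j, ‖b j‖) ^ 2 * (1 * (D1 thetaProf / 4) * Bf * ((ℓ : ℝ) + 1) ^ 4) * (geo9K i).len a *
            Real.exp (-((1 - 9 / 5000) * δC * (geo9K i).dist a a'))
        ≤ P * (1 * 1 * Bf) * (geo9K i).len a * Real.exp (-((1 - 9 / 5000) * δC * (geo9K i).dist a a'))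
          + P * (1 * (D1 thetaProf / 4) * Bf * ((ℓ : ℝ) + 1) ^ 4) * (geo9K i).len a *
            Real.exp (-((1 - 9 / 5000) * δC * (geo9K i).dist a a')) := by
          rw [hP]
          exact add_le_add (kernel_le hd (pow_nonneg (hl a) _) (le_of_eq (by norm_num)) le_rfl (by positivity) hδf) le_rfl
      _ = C2 * (geo9K i).len a * Real.exp (-((1 - 9 / 5000) * δC * (geo9K i).dist a a')) := by rw [hC2]; ring
      _ ≤ Bc * (geo9K i).len a * Real.exp (-((1 - 9 / 5000) * δC * (geo9K i).dist a a')) :=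
          mul_le_mul_of_nonneg_right (mul_le_mul_of_nonneg_right hc2 (hl a)) (Real.exp_nonneg _)
  -- (3.42)₄: `η⁻²Δ_U(η²O_□)`
  have W3 : HasMajorant (g := toB6 (geo9K i) Rr Hp) (fun p : SiteY i × ι => ιB (blkOf i.D.toDomains p.1))
      (conj b (Lscaled i U) * conj b (Gmem i c g A))
      (fun a a' => Bc * 1 * Real.exp (-((1 - 9 / 5000) * δC * (geo9K i).dist a a'))) := by
    have T0 := hasMajorant_conj_site_sandwich_decay i c b hM₂ hrepr (gSiteY i g) hγ (chiY i c) (chiY i c) (c₁ := 1) (c₂ := 1)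
      zero_le_one zero_le_one (m := 0) (n := 0) le_rfl hχ0 hχ hnχ ιB hι Rr Hp Rr Hp hBf hδC.le
      (Lscaled i (locCfgY i c (kGeo i).eta A) * Ginner i c A) E3'
    have Ta := fun μ : Fin (d + 1) => hasMajorant_conj_site_sandwich_decay i c b hM₂ hrepr (gSiteY i g) hγ
      (fun z => ((kGeo i).eta)⁻¹ * (chiY i c (shiftY i μ z) - chiY i c z)) (chiY i c) (c₁ := D1 thetaProf / 4) (c₂ := 1) (by positivity)
      zero_le_one (m := 1) (n := 1) le_rfl (hdp1 μ) hχ hnχ ιB hι Rr Hp Rr Hp hBf hδC.le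
      (diffLetter (shiftY i) (UboxY i (locCfgY i c (kGeo i).eta A)) ((((kGeo i).eta : ℂ))⁻¹) (Sum.inl μ) * Ginner i c A) (E1' (Sum.inl μ))
    have Tb := fun μ : Fin (d + 1) => hasMajorant_conj_site_sandwich_decay i c b hM₂ hrepr (gSiteY i g) hγ
      (fun z => -(((kGeo i).eta)⁻¹ * (chiY i c ((shiftY i μ).symm z) - chiY i c z))) (chiY i c) (c₁ := D1 thetaProf / 4) (c₂ := 1)
      (by positivity) zero_le_one (m := 1) (n := 1) le_rfl (hdm1 μ) hχ hnχ ιB hι Rr Hp Rr Hp hBf hδC.le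
      (diffLetter (shiftY i) (UboxY i (locCfgY i c (kGeo i).eta A)) ((((kGeo i).eta : ℂ))⁻¹) (Sum.inr μ) * Ginner i c A) (E1' (Sum.inr μ))
    have Tc := fun μ : Fin (d + 1) => hasMajorant_conj_site_sandwich_decay i c b hM₂ hrepr (gSiteY i g) hγ
      (fun z => ((kGeo i).eta ^ 2)⁻¹ * (chiY i c (shiftY i μ z) - 2 * chiY i c z + chiY i c ((shiftY i μ).symm z))) (chiY i c)
      (c₁ := 3 * D2 thetaProf / 16) (c₂ := 1) (by positivity) zero_le_one (m := 2) (n := 2) le_rfl (hdd2 μ) hχ hnχ ιB hι Rr Hp Rr Hp hBf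
      hδC.le (Ginner i c A) E0'
    have Tsum := hasMajorant_finset_sum (g := toB6 (geo9K i) Rr Hp) (fun p : SiteY i × ι => ιB (blkOf i.D.toDomains p.1)) Finset.univ _ _
      fun μ _ => hasMajorant_add _ (hasMajorant_add _ (Ta μ) (Tb μ)) (Tc μ)
    have hs0 := hasMajorant_add _ T0 (hasMajorant_neg _ Tsum)
    rw [← sub_eq_add_neg] at hs0
    have hs := hasMajorant_congr_op (T' := conj b (Lscaled i U) * conj b (Gmem i c g A)) hs0 (by
      rw [← B9Eq352DivFormLetters.conj_mul, Lscaled_mul_Gmem i c g U A hNz hAG, conj_sub, conj_finset_sum]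
      simp only [conj_add, SandR])
    refine hasMajorant_mono (g := toB6 (geo9K i) Rr Hp) _ hs fun a a' => ?_
    have hd := geo9K_dist_nonneg i a a'
    have per : ∀ μ : Fin (d + 1),
        (M₂ * ∑ j, ‖b j‖) ^ 2 * (D1 thetaProf / 4 * 1 * Bf) * (geo9K i).len a ^ (1 - 1) * Real.exp (-(δC * (geo9K i).dist a a'))
          + (M₂ * ∑ j, ‖b j‖) ^ 2 * (D1 thetaProf / 4 * 1 * Bf) * (geo9K i).len a ^ (1 - 1) * Real.exp (-(δC * (geo9K i).dist a a'))
          + (M₂ * ∑ j, ‖b j‖) ^ 2 * (3 * D2 thetaProf / 16 * 1 * Bf) * (geo9K i).len a ^ (2 - 2) * Real.exp (-(δC * (geo9K i).dist a a'))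
        ≤ (P * (D1 thetaProf / 4 * 1 * Bf) + P * (D1 thetaProf / 4 * 1 * Bf) + P * (3 * D2 thetaProf / 16 * 1 * Bf)) * 1 *
            Real.exp (-((1 - 9 / 5000) * δC * (geo9K i).dist a a')) := by
      intro μ
      rw [hP]
      calc _ ≤ (M₂ * ∑ j, ‖b j‖) ^ 2 * (D1 thetaProf / 4 * 1 * Bf) * 1 * Real.exp (-((1 - 9 / 5000) * δC * (geo9K i).dist a a'))
            + (M₂ * ∑ j, ‖b j‖) ^ 2 * (D1 thetaProf / 4 * 1 * Bf) * 1 * Real.exp (-((1 - 9 / 5000) * δC * (geo9K i).dist a a'))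
            + (M₂ * ∑ j, ‖b j‖) ^ 2 * (3 * D2 thetaProf / 16 * 1 * Bf) * 1 * Real.exp (-((1 - 9 / 5000) * δC * (geo9K i).dist a a')) :=
            add_le_add (add_le_add (kernel_le hd (pow_nonneg (hl a) _) (le_of_eq (by norm_num)) le_rfl (by positivity) hδf)
              (kernel_le hd (pow_nonneg (hl a) _) (le_of_eq (by norm_num)) le_rfl (by positivity) hδf))
              (kernel_le hd (pow_nonneg (hl a) _) (le_of_eq (by norm_num)) le_rfl (by positivity) hδf)
        _ = _ := by ring
    calc (M₂ * ∑ j, ‖b j‖) ^ 2 * (1 * 1 * Bf) * (geo9K i).len a ^ (0 - 0) * Real.exp (-(δC * (geo9K i).dist a a'))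
          + ∑ μ : Fin (d + 1),
            ((M₂ * ∑ j, ‖b j‖) ^ 2 * (D1 thetaProf / 4 * 1 * Bf) * (geo9K i).len a ^ (1 - 1) * Real.exp (-(δC * (geo9K i).dist a a'))
              + (M₂ * ∑ j, ‖b j‖) ^ 2 * (D1 thetaProf / 4 * 1 * Bf) * (geo9K i).len a ^ (1 - 1) * Real.exp (-(δC * (geo9K i).dist a a'))
              + (M₂ * ∑ j, ‖b j‖) ^ 2 * (3 * D2 thetaProf / 16 * 1 * Bf) * (geo9K i).len a ^ (2 - 2) * Real.exp (-(δC * (geo9K i).dist a a')))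
        ≤ P * (1 * 1 * Bf) * 1 * Real.exp (-((1 - 9 / 5000) * δC * (geo9K i).dist a a'))
          + ∑ _μ : Fin (d + 1), (P * (D1 thetaProf / 4 * 1 * Bf) + P * (D1 thetaProf / 4 * 1 * Bf) + P * (3 * D2 thetaProf / 16 * 1 * Bf)) * 1 *
            Real.exp (-((1 - 9 / 5000) * δC * (geo9K i).dist a a')) := by
          refine add_le_add ?_ (Finset.sum_le_sum fun μ _ => per μ)
          rw [hP]
          exact kernel_le hd (pow_nonneg (hl a) _) (le_of_eq (by norm_num)) le_rfl (by positivity) hδf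
      _ = C3 * 1 * Real.exp (-((1 - 9 / 5000) * δC * (geo9K i).dist a a')) := by
          rw [Finset.sum_const, Finset.card_univ, Fintype.card_fin, nsmul_eq_mul, hC3]; push_cast; ring
      _ ≤ Bc * 1 * Real.exp (-((1 - 9 / 5000) * δC * (geo9K i).dist a a')) :=
          mul_le_mul_of_nonneg_right (mul_le_mul_of_nonneg_right hc3 zero_le_one) (Real.exp_nonneg _)
  -- the writer
  exact eBlock_kernelFamilySInv_of_hasMajorant (i := i) (b := b) (cfg := cfg)
    (O := fun _ => locLetterY i c (parSymY i) g (chiY i c) (locCfgY i c (kGeo i).eta A)) (par := par) (U₁ := U₁) (Rr := Rr) (Hp := Hp)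
    ιB hι hM₂ hrepr hη.symm (by rw [hcfg]) (Gmem i c g A) (Lscaled i U) (fun Λ => Gmem_apply i c g A Λ)
    (fun Λ => by rw [Lscaled_apply, hcfg]) hBc0 W0 W1 W2 W3

end Assembly

end Literature.MathematicalPhysics.QuantumFieldTheory.Balaban1983to89.B9Cor36GpCubeLocAtMember
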